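/-
Copyright (c) 2026 the pub-hodgecm-mathlib formalisation cell (harness21).  Prover seat hodgecm-mathlib-LH4-p09 (g8), req620 Track A «(D-RAM) FOUR-FRAME» squad
(heir dealer LH4-plan (g13) WORD #74 (2): (d) lev-trunk assembly — the generic G1 tube row).  2026-09-04.
-/
import Summits.HodgeConjecture.HodgeConjecture.Theorems.F0P3cDyRamLabelledKappaGluedStratum      -- ★ p859717 (this seat) K1: `finsum_kappaCount_mul_stabiliserWeight_G1_sep_two_of_ne`
import Summits.HodgeConjecture.HodgeConjecture.Theorems.F0P3cDyRamSqTokenReadLetter            -- ★ p860043 (this seat) (o2): `v_sq_sub_sq_le`; brings `isoceles_depths` etc.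
import HarnessLib

/-!
# (D-RAM) four-frame, STAGE 1b — (T-2tok) HEADS, glued, BOTH TOKENS OFF THEIR LOCI: the two-token labelled κ-cell of `G1 (2ρ, 2ρ+s, 2ρ+s)` at the letters of record
# on a datum with `n₁ ≠ n₂ + s` and `2n₁ ≠ 2n₂ + s`, with FULLY NUMERIC reads

Helper brick for dealer LH4-plan (g13) WORD #74 (2) ((d) lev-trunk assembly, this seat): `Theorems/` only, statement-first, ★-only imports, lane
`--supports stmt-HodgeConjecture-24833 --as helper`; it PAYS NO tier-0 row (count-neutral).  Completes T2b ★ p860000 (foot ∕ tube on the `D₁` locus ∕ tube on the `D₂` locus)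
with the generic row: both tokens off their glue loci, so ★ p859717 `…_G1_sep_two_of_ne` applies and the two four-part reads are evaluated:
`reads₁ ⟺ ℓ₁ + 2ρ + s ≤ n₁ ∧ ℓ₁ + 2ρ ≤ n₂`, `reads₂ ⟺ ℓ₂ + 2ρ ≤ 2n₂ ∧ ℓ₂ + 2ρ + s ≤ 2n₁` (the remaining conjuncts, including the symbolic `|(β−1)²−(α−1)²| ≤ |ϖ|^{ℓ₂+ρ}`,
FOLLOW from these by `min(n₁,n₂) ≤ n₃` (★ `isoceles_depths`) and ★ p860043 `v_sq_sub_sq_le`).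

* §1 `modelToken_offLocus_iff`, `sqToken_offLocus_iff`, `levelsTokens_reads_G1_iff`.
* §2 **`finsum_kappaCount_mul_stabiliserWeight_stratum_G1_sep_levels_offLocus`** `= [ℓ₁ + 2ρ + s ≤ n₁ ∧ ℓ₁ + 2ρ ≤ n₂] · [ℓ₂ + 2ρ ≤ 2n₂ ∧ ℓ₂ + 2ρ + s ≤ 2n₁] · (★ κG1 value)`.

HONEST LABEL: helper organs for the (d) assembly of HYPOTHESES (the four lev trunk letters); STAGE-1b tier-0 rows and the ED. 5∕6 law stubs stay OPEN; HC_CM is proved only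
modulo the 7 printed citations (2 remaining named inputs: hLiu418 = `stmt-HodgeConjecture-24832`, h413 = `stmt-HodgeConjecture-24833`) until rung 0 closes.

## References
* [Kottwitz1986BaseChangeUnits] R. E. Kottwitz, *Base change for unit elements of Hecke algebras*, Compositio Math. 60 (1986), §1 pp. 240–241 (lattice counts modulo the torus).
* [Rogawski1990] J. D. Rogawski, *Automorphic Representations of Unitary Groups in Three Variables*, Ann. of Math. Stud. 123 (1990), §4.9 Prop. 4.9.1 (a)(b) p. 55.
* [LanglandsShelstad1987] R. P. Langlands, D. Shelstad, *On the definition of transfer factors*, Math. Ann. 278 (1987), §3 (κ as a character).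
-/

set_option autoImplicit false

noncomputable section

namespace Summit.HodgeConjecture.HodgeConjecture.Cruxes.H413.F0P3cDyRamLabelledKappaTwoTokenGluedOffLocus

open Matrix WithZero
open Literature.NumberTheory.Automorphic Literature.NumberTheory.Automorphic.HermitianLattice
open Literature.NumberTheory.Automorphic.UnitaryLatticeTree Literature.NumberTheory.Automorphic.UnitaryThreeFourFrame
open Literature.NumberTheory.LocalFields.WildQuadraticDatum
open Summit.HodgeConjecture.HodgeConjecture.Cruxes.H413.F0P3cDyRamDiagonalTorusDefs
open Summit.HodgeConjecture.HodgeConjecture.Cruxes.H413.F0P3cDyRamDiagonalStrataDefs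
open Summit.HodgeConjecture.HodgeConjecture.Cruxes.H413.F0P3cDyRamDiagonalKappaCountDefs
open Summit.HodgeConjecture.HodgeConjecture.Cruxes.H413.F0P3cDyRamDiagonalGluedStabiliserIndex (ne_zero_and_v_lt_one_of_v_eq_exp)
open Summit.HodgeConjecture.HodgeConjecture.Cruxes.H413.F0P3cDyRamFourFrameCensusDefs
open Summit.HodgeConjecture.HodgeConjecture.Cruxes.H413.F0P3cDyRamLabelledKappaGluedStratum (finsum_kappaCount_mul_stabiliserWeight_G1_sep_two_of_ne)
open Summit.HodgeConjecture.HodgeConjecture.Cruxes.H413.F0P3cDyRamSqTokenReadLetter (v_sq_sub_sq_le)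
open scoped Valued WithZero Matrix MatrixGroups

/-! ## §1  Off-locus criteria and the numeric reads -/

section Reads

variable {K : Type*} [Field K] [Valued K ℤᵐ⁰]

/-- `D₁ = diag(α−1, β−1, 0)` is off the glue locus of `G1(ρ, s)` iff `n₁ ≠ n₂ + s`. [cite: Kottwitz1986BaseChangeUnits, §1 pp. 240–241] -/
theorem modelToken_offLocus_iff {ϖ α β : K} (hϖ : Valued.v ϖ = exp (-1 : ℤ)) {n₁ n₂ : ℕ} (h₁ : Valued.v (β - 1) = Valued.v ϖ ^ n₁)
    (h₂ : Valued.v (α - 1) = Valued.v ϖ ^ n₂) (s : ℕ) :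
    Valued.v ((![α - 1, β - 1, 0] : Fin 3 → K) 2 - (![α - 1, β - 1, 0] : Fin 3 → K) 1) ≠
        Valued.v ((![α - 1, β - 1, 0] : Fin 3 → K) 2 - (![α - 1, β - 1, 0] : Fin 3 → K) 0) * Valued.v ϖ ^ s ↔ n₁ ≠ n₂ + s := by
  have hple : ∀ m n : ℕ, Valued.v ϖ ^ m ≤ Valued.v ϖ ^ n ↔ n ≤ m := fun m n => UnitaryLatticeTree.v_pow_le_v_pow_iff hϖ m n
  have hpeq : ∀ m n : ℕ, Valued.v ϖ ^ m = Valued.v ϖ ^ n ↔ m = n := fun m n =>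
    ⟨fun h => le_antisymm ((hple n m).1 h.ge) ((hple m n).1 h.le), fun h => by rw [h]⟩
  simp only [Matrix.cons_val_zero, Matrix.cons_val_one, Matrix.cons_val_two, Matrix.tail_cons, Matrix.head_cons, zero_sub, Valuation.map_neg, h₁, h₂,
    ← pow_add, Ne, hpeq]

/-- `D₂ = diag((α−1)², (β−1)², 0)` is off the glue locus of `G1(ρ, s)` iff `2n₁ ≠ 2n₂ + s`. [cite: Kottwitz1986BaseChangeUnits, §1 pp. 240–241] -/
theorem sqToken_offLocus_iff {ϖ α β : K} (hϖ : Valued.v ϖ = exp (-1 : ℤ)) {n₁ n₂ : ℕ} (h₁ : Valued.v (β - 1) = Valued.v ϖ ^ n₁)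
    (h₂ : Valued.v (α - 1) = Valued.v ϖ ^ n₂) (s : ℕ) :
    Valued.v ((![(α - 1) * (α - 1), (β - 1) * (β - 1), 0] : Fin 3 → K) 2 - (![(α - 1) * (α - 1), (β - 1) * (β - 1), 0] : Fin 3 → K) 1) ≠
        Valued.v ((![(α - 1) * (α - 1), (β - 1) * (β - 1), 0] : Fin 3 → K) 2 - (![(α - 1) * (α - 1), (β - 1) * (β - 1), 0] : Fin 3 → K) 0) *
          Valued.v ϖ ^ s ↔ 2 * n₁ ≠ 2 * n₂ + s := by
  have hple : ∀ m n : ℕ, Valued.v ϖ ^ m ≤ Valued.v ϖ ^ n ↔ n ≤ m := fun m n => UnitaryLatticeTree.v_pow_le_v_pow_iff hϖ m n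
  have hpeq : ∀ m n : ℕ, Valued.v ϖ ^ m = Valued.v ϖ ^ n ↔ m = n := fun m n =>
    ⟨fun h => le_antisymm ((hple n m).1 h.ge) ((hple m n).1 h.le), fun h => by rw [h]⟩
  simp only [Matrix.cons_val_zero, Matrix.cons_val_one, Matrix.cons_val_two, Matrix.tail_cons, Matrix.head_cons, zero_sub, Valuation.map_neg, map_mul, h₁, h₂,
    ← pow_add, ← two_mul, Ne, hpeq]

/-- **THE TWO FOUR-PART READS OF `(D₁, ℓ₁; D₂, ℓ₂)` ON `G1(ρ, s)` ARE NUMERIC** (datum `(n₁, n₂, n₃)` with `min(n₁,n₂) ≤ n₃`):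
`reads₁ ∧ reads₂ ⟺ (ℓ₁ + 2ρ + s ≤ n₁ ∧ ℓ₁ + 2ρ ≤ n₂) ∧ (ℓ₂ + 2ρ ≤ 2n₂ ∧ ℓ₂ + 2ρ + s ≤ 2n₁)` — the symbolic conjunct `|(β−1)²−(α−1)²| ≤ |ϖ|^{ℓ₂+ρ}` follows from
`|…| ≤ |ϖ|^{n₃+min(n₁,n₂)}` (★ p860043) and `ℓ₂ + 2ρ ≤ 2·min`. [cite: Kottwitz1986BaseChangeUnits, §1 pp. 240–241] [cite: Rogawski1990, §4.9 Prop. 4.9.1 (a) p. 55] -/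
theorem levelsTokens_reads_G1_iff {ϖ α β : K} (hϖ : Valued.v ϖ = exp (-1 : ℤ)) {n₁ n₂ n₃ : ℕ} (h₁ : Valued.v (β - 1) = Valued.v ϖ ^ n₁)
    (h₂ : Valued.v (α - 1) = Valued.v ϖ ^ n₂) (h₃ : Valued.v (α - β) = Valued.v ϖ ^ n₃) (hmin : min n₁ n₂ ≤ n₃) (ℓ₁ ℓ₂ ρ s : ℕ) :
    ((((Valued.v ((![α - 1, β - 1, 0] : Fin 3 → K) 0) ≤ Valued.v ϖ ^ ℓ₁ ∧ Valued.v ((![α - 1, β - 1, 0] : Fin 3 → K) 1) ≤ Valued.v ϖ ^ ℓ₁ ∧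
            Valued.v ((![α - 1, β - 1, 0] : Fin 3 → K) 2) ≤ Valued.v ϖ ^ ℓ₁) ∧
          Valued.v ((![α - 1, β - 1, 0] : Fin 3 → K) 1 - (![α - 1, β - 1, 0] : Fin 3 → K) 0) ≤ Valued.v ϖ ^ (ℓ₁ + ρ) ∧
          Valued.v ((![α - 1, β - 1, 0] : Fin 3 → K) 2 - (![α - 1, β - 1, 0] : Fin 3 → K) 1) ≤ Valued.v ϖ ^ (ℓ₁ + ρ + s) ∧
          (Valued.v ((![α - 1, β - 1, 0] : Fin 3 → K) 2 - (![α - 1, β - 1, 0] : Fin 3 → K) 1) ≤ Valued.v ϖ ^ (ℓ₁ + 2 * ρ + s) ∧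
            Valued.v ((![α - 1, β - 1, 0] : Fin 3 → K) 2 - (![α - 1, β - 1, 0] : Fin 3 → K) 0) * Valued.v ϖ ^ s ≤ Valued.v ϖ ^ (ℓ₁ + 2 * ρ + s))) ∧
        (((Valued.v ((![(α - 1) * (α - 1), (β - 1) * (β - 1), 0] : Fin 3 → K) 0) ≤ Valued.v ϖ ^ ℓ₂ ∧
            Valued.v ((![(α - 1) * (α - 1), (β - 1) * (β - 1), 0] : Fin 3 → K) 1) ≤ Valued.v ϖ ^ ℓ₂ ∧
            Valued.v ((![(α - 1) * (α - 1), (β - 1) * (β - 1), 0] : Fin 3 → K) 2) ≤ Valued.v ϖ ^ ℓ₂) ∧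
          Valued.v ((![(α - 1) * (α - 1), (β - 1) * (β - 1), 0] : Fin 3 → K) 1 - (![(α - 1) * (α - 1), (β - 1) * (β - 1), 0] : Fin 3 → K) 0) ≤
              Valued.v ϖ ^ (ℓ₂ + ρ) ∧
          Valued.v ((![(α - 1) * (α - 1), (β - 1) * (β - 1), 0] : Fin 3 → K) 2 - (![(α - 1) * (α - 1), (β - 1) * (β - 1), 0] : Fin 3 → K) 1) ≤
              Valued.v ϖ ^ (ℓ₂ + ρ + s) ∧
          (Valued.v ((![(α - 1) * (α - 1), (β - 1) * (β - 1), 0] : Fin 3 → K) 2 - (![(α - 1) * (α - 1), (β - 1) * (β - 1), 0] : Fin 3 → K) 1) ≤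
              Valued.v ϖ ^ (ℓ₂ + 2 * ρ + s) ∧
            Valued.v ((![(α - 1) * (α - 1), (β - 1) * (β - 1), 0] : Fin 3 → K) 2 - (![(α - 1) * (α - 1), (β - 1) * (β - 1), 0] : Fin 3 → K) 0) *
                Valued.v ϖ ^ s ≤ Valued.v ϖ ^ (ℓ₂ + 2 * ρ + s)))) ↔
      (ℓ₁ + 2 * ρ + s ≤ n₁ ∧ ℓ₁ + 2 * ρ ≤ n₂) ∧ (ℓ₂ + 2 * ρ ≤ 2 * n₂ ∧ ℓ₂ + 2 * ρ + s ≤ 2 * n₁))) := by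
  obtain ⟨hϖ0, hϖ1⟩ := ne_zero_and_v_lt_one_of_v_eq_exp hϖ
  have hple : ∀ m n : ℕ, Valued.v ϖ ^ m ≤ Valued.v ϖ ^ n ↔ n ≤ m := fun m n => UnitaryLatticeTree.v_pow_le_v_pow_iff hϖ m n
  have h₃' : Valued.v (β - 1 - (α - 1)) = Valued.v ϖ ^ n₃ := by rw [show β - 1 - (α - 1) = β - α by ring, Valuation.map_sub_swap, h₃]
  have hsq := v_sq_sub_sq_le hϖ1.le h₁ h₂ h₃
  simp only [Matrix.cons_val_zero, Matrix.cons_val_one, Matrix.cons_val_two, Matrix.tail_cons, Matrix.head_cons, zero_sub, Valuation.map_neg, map_zero,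
    zero_le, and_true, map_mul, h₁, h₂, h₃', ← pow_add, hple]
  constructor
  · rintro ⟨⟨-, -, -, h1, h2⟩, -, -, -, h3, h4⟩
    exact ⟨⟨by omega, by omega⟩, by omega, by omega⟩
  · rintro ⟨⟨h1, h2⟩, h3, h4⟩
    refine ⟨⟨⟨by omega, by omega⟩, ?_, by omega, by omega, by omega⟩, ⟨by omega, by omega⟩, ?_, by omega, by omega, by omega⟩
    · rcases le_total n₁ n₂ with h | h
      · rw [min_eq_left h] at hmin; omega
      · rw [min_eq_right h] at hmin; omega
    · refine hsq.trans ((hple _ _).2 ?_)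
      rcases le_total n₁ n₂ with h | h
      · rw [min_eq_left h] at hmin ⊢; omega
      · rw [min_eq_right h] at hmin ⊢; omega

end Reads

/-! ## §2  The generic row -/

section Head

variable {K : Type} [Field K] [Valued K ℤᵐ⁰] [CompleteSpace K] [Fintype 𝓀[K]] {σ : K →+* K} {ϖ : K} {d t : ℕ} {α β : K} {N₀ n₁ n₂ n₃ : ℕ}
  {T : GL (Fin 3) K}

/-- **HEAD — TWO-TOKEN κ-WEIGHTED G1 CELL AT THE LETTERS OF RECORD, BOTH TOKENS OFF THEIR LOCI** (`n₁ ≠ n₂ + s`, `2n₁ ≠ 2n₂ + s`; any regime):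
`Σᶠ_{M ∈ G1(ρ,s), D₁M ⊆ ϖ^{ℓ₁}M ∧ D₂M ⊆ ϖ^{ℓ₂}M} κᵢ(M)·w(M) = [ℓ₁ + 2ρ + s ≤ n₁ ∧ ℓ₁ + 2ρ ≤ n₂] · [ℓ₂ + 2ρ ≤ 2n₂ ∧ ℓ₂ + 2ρ + s ≤ 2n₁] · (★ κG1 value)`
(★ p859717 `…_G1_sep_two_of_ne` with §1's numeric reads). [cite: Kottwitz1986BaseChangeUnits, §1 pp. 240–241] [cite: LanglandsShelstad1987, §3]
[cite: Rogawski1990, §4.9 Prop. 4.9.1 (a)(b) p. 55] -/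
theorem finsum_kappaCount_mul_stabiliserWeight_stratum_G1_sep_levels_offLocus (hD : IsRamifiedQuadraticDatum σ ϖ d t) (h2 : Valued.v (2 : K) < 1)
    (hE : IsElementDatum σ ϖ N₀ α β n₁ n₂ n₃) (hN₀ : d ≤ N₀) (hT : (T : Matrix (Fin 3) (Fin 3) K) = Matrix.diagonal ![α, β, 1])
    (ρ s : ℕ) (hρ : 1 ≤ ρ) (hs : 1 ≤ s) (hne₁ : n₁ ≠ n₂ + s) (hne₂ : 2 * n₁ ≠ 2 * n₂ + s) (i : Fin 3) (ℓ₁ ℓ₂ : ℕ) (f₀ : K) (hσf₀ : σ f₀ = f₀)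
    (hglue : 2 ∣ s → n₂ = n₃ → n₁ = n₂ + s → n₂ < 2 * ρ → 2 * ρ - n₂ ≤ n₂ - d + 1 → Valued.v (f₀ + (β - 1) / (α - 1)) ≤ Valued.v ϖ ^ (2 * ρ + s - n₂)) :
    ∑ᶠ M ∈ {M | M ∈ stratum σ ϖ T ![2 * ρ, 2 * ρ + s, 2 * ρ + s] ∧
        (LatticeInLevel ϖ ℓ₁ (Matrix.diagonal ![α - 1, β - 1, 0]) M ∧ LatticeInLevel ϖ ℓ₂ (Matrix.diagonal ![(α - 1) * (α - 1), (β - 1) * (β - 1), 0]) M)},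
        (kappaCount σ ϖ 0 i M : ℚ) * stabiliserWeight σ M =
      if (ℓ₁ + 2 * ρ + s ≤ n₁ ∧ ℓ₁ + 2 * ρ ≤ n₂) ∧ (ℓ₂ + 2 * ρ ≤ 2 * n₂ ∧ ℓ₂ + 2 * ρ + s ≤ 2 * n₁) then
        ((if 2 ∣ s ∧ 2 * ρ ≤ min n₂ n₃ ∧ 2 * ρ + s ≤ n₁ then
            (![(normSign σ (-1 : K) : ℚ) * (Fintype.card 𝓀[K] : ℚ) ^ (2 * ρ + s / 2 - 1) *
                ((if 2 * d ≤ s then (Fintype.card 𝓀[K] : ℚ) - 1 else 0) - (if s + 2 = 2 * d then 1 else 0)), 0, 0] : Fin 3 → ℚ) i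
          else 0) +
        (if 2 ∣ s ∧ n₂ = n₃ ∧ n₁ = n₂ + s ∧ n₂ < 2 * ρ ∧ 2 * ρ - n₂ ≤ n₂ - d + 1 then
            (![if 2 * d ≤ s + 2 * ((2 * ρ - n₂ + 1) / 2) then (normSign σ (-1 : K) : ℚ) * normSign σ (1 + f₀) else 0,
               if d ≤ (2 * ρ - n₂ + 1) / 2 then (normSign σ (-1 : K) : ℚ) * normSign σ f₀ * normSign σ (1 + f₀) else 0,
               if d ≤ (2 * ρ - n₂ + 1) / 2 then (normSign σ f₀ : ℚ) else 0] : Fin 3 → ℚ) i *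
              (Fintype.card 𝓀[K] : ℚ) ^ (2 * ρ + s / 2 - (2 * ρ - n₂ + 1) / 2)
          else 0))
      else 0 := by
  classical
  have hϖ : Valued.v ϖ = exp (-1 : ℤ) := hD.2.2.1
  obtain ⟨-, -, -, -, -, h₁, h₂, h₃, -, -, -⟩ := id hE
  obtain ⟨hmin, -, -⟩ := isoceles_depths hϖ h₁ h₂ h₃
  rw [finsum_kappaCount_mul_stabiliserWeight_G1_sep_two_of_ne hD h2 hE hN₀ hT ρ s hρ hs i f₀ hσf₀ hglue ℓ₁ ℓ₂ _ _
      ((modelToken_offLocus_iff hϖ h₁ h₂ s).2 hne₁) ((sqToken_offLocus_iff hϖ h₁ h₂ s).2 hne₂),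
    if_congr (levelsTokens_reads_G1_iff hϖ h₁ h₂ h₃ hmin ℓ₁ ℓ₂ ρ s) rfl rfl]

end Head

end Summit.HodgeConjecture.HodgeConjecture.Cruxes.H413.F0P3cDyRamLabelledKappaTwoTokenGluedOffLocus

end
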